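/-
Copyright (c) 2026 the pub-hodgecm-mathlib formalisation cell (harness21).  Prover seat hodgecm-mathlib-LH4-p05 (g4), req620 Track A «(D-RAM) FOUR-FRAME» squad F0∕P3c∕LH4,
unit (ii-H), leaf (ρ2b′-X): organ S2′ companion — the Unr-K ∕ RamK DICHOTOMY on type U in one-field currency (the payer's case split between ★ p857839
`exists_thirdFieldPackage_unr` and the ramified third-field package).  2026-09-04.
-/
import Mathlib.Topology.Algebra.Valued.ValuedField
import Mathlib.Topology.Algebra.Valued.WithZeroMulInt
import HarnessLib

/-!
# Crux `H413`, line LH4 «(D-RAM) FOUR-FRAME» — leaf (ρ2b′-X), S2′ companion: THE Unr-K ∕ RamK DICHOTOMY OF A TYPE-U FRAME, ELEMENTARY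

Cell `hodgecm-mathlib` (D-0151), FLOOR 0, crux item H413 = `stmt-HodgeConjecture-24833`, route of record `HCCMUnconditional`; squad F0∕P3c∕LH4.  THEOREMS ONLY (no `def`,
no instance, no notation, no named fact, no `sorry`); lane `--supports stmt-HodgeConjecture-24833 --as helper` (count-neutral).

In the one-field currency of the four-involution frame (`K` a model of `M`, `ρ = Gal(M ∕ E)`, `Θ` the adjoint involution, `α` integral), the payer's census splits
type U (`|α − ρα| = 1`, `M ∕ E` unramified) into Unr-K (`|ρα − Θα| < 1`: `M ∕ K♮` unramified — ★ p857839 `F0P3cDyRamThirdFieldPackageUnr.exists_thirdFieldPackage_unr`)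
and RamK (`|α − Θα| < 1`: `Θ` residually trivial, `M ∕ K♮` ramified — the ramified third-field package).  THIS FILE proves that the split is a clean DICHOTOMY from
ONE residual letter of the ramified `E ∕ F` — `hσres : ρ-fixed integers are moved by Θ into the maximal ideal` (`σ_w` is residually trivial on `𝓀_E = 𝓀_F`) — with NO
finite-field Galois theory: since `α² = T·α − N` with `T = α + ρα`, `N = α·ρα` fixed by `ρ`,
`(Θα − α)·(Θα − ρα) = (ΘT − T)·Θα − (ΘN − N)` has order `> 0`, so one factor does (`typeU_dichotomy`); and not both, as their difference `α − ρα` is a unit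
(`not_unrK_and_ramK`); hence `|ρα − Θα| < 1 ↔ ¬ |α − Θα| < 1` (`unrK_iff_not_ramK`).
HONEST LABEL: HC_CM is proved only modulo the 7 printed citations (2 remaining named inputs: hLiu418 = stmt-HodgeConjecture-24832, h413 = stmt-HodgeConjecture-24833)
until rung 0 closes; (ρ2b′-X) stays an OPEN prover target; helper (`--supports`), proofs only.

## References
* [Serre1979] J.-P. Serre, *Local Fields*, GTM 67 (1979), Ch. I §7 Prop. 20–21 and Ch. IV §1 (inertia: an automorphism of an unramified extension is determined by
  its action on the residue field; here replaced by the quadratic relation of `α`).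
* [Rogawski1990] J. D. Rogawski, *Automorphic Representations of Unitary Groups in Three Variables*, Ann. of Math. Stud. 123 (1990), §4.9 Lemma 4.9.3 p. 56 (the
  two commuting involutions of the eigen-field and its three quadratic subfields).
-/

set_option autoImplicit false

noncomputable section

open WithZero
open scoped Valued

namespace Summit.HodgeConjecture.HodgeConjecture.Cruxes.H413.F0P3cDyRamTypeUThirdFieldDichotomy

variable {K : Type*} [Field K] [Valued K ℤᵐ⁰] {ρ Θ : K →+* K}

omit [Valued K ℤᵐ⁰] in
/-- **The quadratic relation of `α` read through `Θ`**: `(Θα − α)(Θα − ρα) = (ΘT − T)·Θα − (ΘN − N)` with `T = α + ρα`, `N = α·ρα`. -/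
theorem map_sub_mul_map_sub_eq (α : K) :
    (Θ α - α) * (Θ α - ρ α) = (Θ (α + ρ α) - (α + ρ α)) * Θ α - (Θ (α * ρ α) - α * ρ α) := by
  rw [Θ.map_add, Θ.map_mul]; ring

/-- **TYPE-U DICHOTOMY**: if the `ρ`-fixed integers are residually fixed by `Θ` (`σ_w` residually trivial — `E ∕ F` totally ramified), then for every integral
`α`: `|ρα − Θα| < 1` (Unr-K) or `|α − Θα| < 1` (RamK). [cite: Serre1979, Ch. I §7 Prop. 21] -/
theorem typeU_dichotomy (hρρ : ∀ x, ρ (ρ x) = x) (hvρ : ∀ x, Valued.v (ρ x) = Valued.v x) (hvΘ : ∀ x, Valued.v (Θ x) = Valued.v x)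
    (hσres : ∀ z : K, ρ z = z → Valued.v z ≤ 1 → Valued.v (Θ z - z) < 1) {α : K} (hα1 : Valued.v α ≤ 1) :
    Valued.v (ρ α - Θ α) < 1 ∨ Valued.v (α - Θ α) < 1 := by
  have hρα1 : Valued.v (ρ α) ≤ 1 := (hvρ α).le.trans hα1
  have hT : Valued.v (Θ (α + ρ α) - (α + ρ α)) < 1 :=
    hσres _ (by rw [ρ.map_add, hρρ, add_comm]) ((Valuation.map_add _ _ _).trans (max_le hα1 hρα1))
  have hN : Valued.v (Θ (α * ρ α) - α * ρ α) < 1 :=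
    hσres _ (by rw [ρ.map_mul, hρρ, mul_comm]) (by
      rw [Valuation.map_mul]
      calc Valued.v α * Valued.v (ρ α) ≤ 1 * 1 := mul_le_mul' hα1 hρα1
        _ = 1 := mul_one _)
  have hprod : Valued.v ((Θ α - α) * (Θ α - ρ α)) < 1 := by
    rw [map_sub_mul_map_sub_eq α]
    refine (Valuation.map_sub _ _ _).trans_lt (max_lt ?_ hN)
    rw [Valuation.map_mul, hvΘ]
    calc Valued.v (Θ (α + ρ α) - (α + ρ α)) * Valued.v α ≤ Valued.v (Θ (α + ρ α) - (α + ρ α)) * 1 := mul_le_mul_right hα1 _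
      _ < 1 := by rw [mul_one]; exact hT
  have h1 : Valued.v (Θ α - α) ≤ 1 := (Valuation.map_sub _ _ _).trans (max_le (by rw [hvΘ]; exact hα1) hα1)
  have h2 : Valued.v (Θ α - ρ α) ≤ 1 := (Valuation.map_sub _ _ _).trans (max_le (by rw [hvΘ]; exact hα1) hρα1)
  rw [Valuation.map_mul] at hprod
  by_contra h
  rw [not_or, Valuation.map_sub_swap _ (ρ α), Valuation.map_sub_swap _ α, not_lt, not_lt] at h
  have e1 : Valued.v (Θ α - α) = 1 := le_antisymm h1 h.2
  have e2 : Valued.v (Θ α - ρ α) = 1 := le_antisymm h2 h.1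
  rw [e1, e2, mul_one] at hprod
  exact lt_irrefl _ hprod

/-- **Not both**: `|α − ρα| = 1` forbids `|ρα − Θα| < 1 ∧ |α − Θα| < 1` (their difference is the unit `α − ρα`). -/
theorem not_unrK_and_ramK {α : K} (hα : Valued.v (α - ρ α) = 1) :
    ¬ (Valued.v (ρ α - Θ α) < 1 ∧ Valued.v (α - Θ α) < 1) := by
  rintro ⟨h1, h2⟩
  have : Valued.v (α - ρ α) < 1 := by
    rw [show α - ρ α = (α - Θ α) - (ρ α - Θ α) by ring]
    exact (Valuation.map_sub _ _ _).trans_lt (max_lt h2 h1)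
  rw [hα] at this
  exact lt_irrefl _ this

/-- **Unr-K ⟺ ¬ RamK on type U** (`|α − ρα| = 1`, `σ_w` residually trivial): the case-definer of ★ `exists_thirdFieldPackage_unr` is the negation of the ramified
third field's. [cite: Serre1979, Ch. I §7 Prop. 21] -/
theorem unrK_iff_not_ramK (hρρ : ∀ x, ρ (ρ x) = x) (hvρ : ∀ x, Valued.v (ρ x) = Valued.v x) (hvΘ : ∀ x, Valued.v (Θ x) = Valued.v x)
    (hσres : ∀ z : K, ρ z = z → Valued.v z ≤ 1 → Valued.v (Θ z - z) < 1) {α : K} (hα1 : Valued.v α ≤ 1)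
    (hα : Valued.v (α - ρ α) = 1) :
    Valued.v (ρ α - Θ α) < 1 ↔ ¬ Valued.v (α - Θ α) < 1 :=
  ⟨fun h h' => not_unrK_and_ramK hα ⟨h, h'⟩, fun h' => (typeU_dichotomy hρρ hvρ hvΘ hσres hα1).resolve_right h'⟩

/-- **RamK ⟹ `Θ` RESIDUALLY TRIVIAL ON ALL OF `𝒪_M`** (the `hΘres` letter of the ramified third-field package): if `|α − ρα| = 1`, `|α − Θα| < 1` and the
`ρ`-fixed integers are residually `Θ`-fixed, then every integer `z` has `|z − Θz| < 1` — via the coordinates `z − Θz = (x − Θx) + (y − Θy)·α + Θy·(α − Θα)`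
of `z = x + y·α` (`x, y` `ρ`-fixed integers: `y = (z − ρz)∕(α − ρα)`). [cite: Serre1979, Ch. I §6 Prop. 18] -/
theorem v_sub_map_lt_one_of_ramK (hρρ : ∀ x, ρ (ρ x) = x) (hvρ : ∀ x, Valued.v (ρ x) = Valued.v x) (hvΘ : ∀ x, Valued.v (Θ x) = Valued.v x)
    (hσres : ∀ z : K, ρ z = z → Valued.v z ≤ 1 → Valued.v (Θ z - z) < 1) {α : K} (hα1 : Valued.v α ≤ 1)
    (hα : Valued.v (α - ρ α) = 1) (hram : Valued.v (α - Θ α) < 1) (z : K) (hz : Valued.v z ≤ 1) :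
    Valued.v (z - Θ z) < 1 := by
  have hα0 : α - ρ α ≠ 0 := fun h => by rw [h, Valuation.map_zero] at hα; exact zero_ne_one hα
  -- coordinates `z = x + y α` with `x, y` fixed by `ρ`
  set y : K := (z - ρ z) / (α - ρ α) with hy
  have hρy : ρ y = y := by
    rw [hy, map_div₀, ρ.map_sub, ρ.map_sub, hρρ, hρρ, ← neg_sub z, ← neg_sub α, neg_div_neg_eq]
  set x : K := z - y * α with hx
  have hρx : ρ x = x := by
    have : x - ρ x = (z - ρ z) - y * (α - ρ α) := by rw [hx, ρ.map_sub, ρ.map_mul, hρy]; ring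
    rw [hy, div_mul_cancel₀ _ hα0, sub_self, sub_eq_zero] at this
    exact this.symm
  have hvy : Valued.v y ≤ 1 := by
    rw [hy, map_div₀, hα, div_one]
    exact (Valuation.map_sub _ _ _).trans (max_le hz (by rw [hvρ]; exact hz))
  have hvx : Valued.v x ≤ 1 := by
    rw [hx]
    refine (Valuation.map_sub _ _ _).trans (max_le hz ?_)
    rw [Valuation.map_mul]
    calc Valued.v y * Valued.v α ≤ 1 * 1 := mul_le_mul' hvy hα1
      _ = 1 := mul_one _
  have hzx : z = x + y * α := by rw [hx]; ring
  have hkey : z - Θ z = -(Θ x - x) + (-(Θ y - y)) * α + Θ y * (α - Θ α) := by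
    conv_lhs => rw [hzx]
    rw [Θ.map_add, Θ.map_mul]; ring
  rw [hkey]
  refine (Valuation.map_add _ _ _).trans_lt (max_lt ((Valuation.map_add _ _ _).trans_lt (max_lt ?_ ?_)) ?_)
  · rw [Valuation.map_neg]; exact hσres x hρx hvx
  · rw [Valuation.map_mul, Valuation.map_neg]
    calc Valued.v (Θ y - y) * Valued.v α ≤ Valued.v (Θ y - y) * 1 := mul_le_mul_right hα1 _
      _ < 1 := by rw [mul_one]; exact hσres y hρy hvy
  · rw [Valuation.map_mul, hvΘ]
    calc Valued.v y * Valued.v (α - Θ α) ≤ 1 * Valued.v (α - Θ α) := mul_le_mul_left hvy _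
      _ < 1 := by rw [one_mul]; exact hram

end Summit.HodgeConjecture.HodgeConjecture.Cruxes.H413.F0P3cDyRamTypeUThirdFieldDichotomy

end
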